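import Mathlib
import HarnessLib

/-!
# Seed crux `SignedMuSeedAtTwoPlus` (stmt-BirchSwinnertonDyer-21438), line `norm-field-tilt`:
# stub S2 `TiltRecursion` as kernel theorems (power-series algebra in characteristic 2)

Cell `bsd-wall`, width seat `bsd-wall-rtt-p4-w2` g10.  Parent crux `SignedMuVanishingAtTwoPlus`
(stmt-BirchSwinnertonDyer-20689), line `birth` v4.9, whose stub `stub_residualSeedAtTwo` IS the seed item 21438.
HONEST FRAMING: THEOREMS ONLY; pure algebra of formal power series over a ring of characteristic `2`; closes no item;
the seed line `norm-field-tilt` (crux-ideate k2 g12, `Cruxes/SignedMuSeedAtTwoPlus/Lines/norm-field-tilt.md`) is NOT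
registered; BSD is NOT proved by any of this.

## What the line needs and what is proved here

The line tilts the elliptic-unit norm system into the field of norms `𝔽₄((s̄))` and reads the fine half `(F)` of the
seed off ONE odd `s̄`-digit of `Z'_{ρ,m} ∈ 𝔽₄⟦t̄⟧`; the digits are controlled by `S_m := D log Z'_{ρ,m}` where
`D = u · d/dt̄` (`u = F₂(t̄,0)`) is the invariant derivation of the (supersingular, height-2) formal group `t ⊕ y = F(t,y)`.
Its stub S2 `TiltRecursion` is the list of identities (a)–(d) and the CLAIM
`v(S_m) < 4^{m+1} − 2 ⟹ v(S_{m+1}) = 2·v(S_m) + 4^{m+1}`; its stub S3 `TiltThreshold` is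
`v(S_m) < e − v(Z') ⟹ OddDigit(m)`.  Everything is typed here over an ARBITRARY commutative ring `k` of characteristic
`2` (a domain where the statement needs it), with the formal group entering only through the shape
`φ = X + u·y + y²·r` of the translation `t ↦ t ⊕ y` and the invariance identity `u·φ' = u∘φ` (`[h]^*ω = ω`):

* (a) `derivative_derivative_eq_zero` (`f'' = 0` in char 2), `derivative_eq_zero_iff_forall_odd` (`u' = 0 ↔ u ∈ k⟦t²⟧`),
  `mul_derivative_mul_derivative_eq_zero` (`u' = 0 ⟹ D∘D = 0`) and the converse `derivative_eq_zero_of_DD_X`;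
* (b) `mul_derivative_eq_sq_of_logDeriv` — `Z·S = D Z`, `u' = 0`, `Z ≠ 0` ⟹ `D S = S²`;
* the bookkeeping `logDeriv_mul` (`D log` of a product) and `logDeriv_subst` / `mul_derivative_subst_of_invariant`
  (`D (f∘φ) = (D f)∘φ` under `u·φ' = u∘φ`), so `S_{m+1} = S_m + S_m∘φ` serves `Z_{m+1} = Z_m·(Z_m∘φ)`
  (`logDeriv_levelStep`);
* (d) the second-order TAYLOR bound `le_order_taylorRemainder`:
  `ord δ ≥ N ≥ 1`, `ord f ≥ v` ⟹ `ord (f(X+δ) − f − f'·δ) ≥ 2N + v − 2` (via `le_order_binomialRemainder`,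
  `ord ((X+δ)^{m+1} − X^{m+1} − (m+1)X^m δ) ≥ m + 2N − 1`, by induction — no binomial sums);
* CLAIM `order_add_subst_eq` / `tiltRecursion_step` — `D S = S²`, `φ = X + u y + y² r`, `ord S = v`, `ord y = N`,
  `v + 2 < N` ⟹ `ord (S + S∘φ) = 2v + N` (the `n = 1` Taylor term `S²·y` is the unique minimum).

Companion file `…SignedMuSeedAtTwoPlusTiltThreshold.lean` (same seat): the `ℕ`-glue (non-degeneracy propagates, closed
form, eventual threshold) and stub S3 `TiltThreshold` (even digits ⟹ `ord Z' ≥ e`, i.e. `OddDigit`).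
Not here (deliberately): the dictionary S1 (Lubin–Tate tower of the CM formal group at `2`, Robert's function, field of
norms), the hard stub S4 `SeedNonDegOnHabitat`, and the descent S5 — none of which is algebra of this size.
[folklore]
-/

noncomputable section

set_option autoImplicit false
set_option linter.dupNamespace false

open PowerSeries

namespace Summit.BirchSwinnertonDyer.BirchSwinnertonDyer.Theorems.SignedMuAtTwo.Tilt

variable {k : Type*} [CommRing k]

/-! ## Small order helpers -/

/-- If `n ≤ ord φ` and `n ≤ ord ψ` then `n ≤ ord (φ + ψ)`. [folklore] -/
theorem le_order_add_of_le {φ ψ : PowerSeries k} {n : ℕ∞} (h₁ : n ≤ φ.order) (h₂ : n ≤ ψ.order) :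
    n ≤ (φ + ψ).order :=
  (le_min h₁ h₂).trans (min_order_le_order_add φ ψ)

/-- If `n ≤ ord φ` and `n ≤ ord ψ` then `n ≤ ord (φ - ψ)`. [folklore] -/
theorem le_order_sub_of_le {φ ψ : PowerSeries k} {n : ℕ∞} (h₁ : n ≤ φ.order) (h₂ : n ≤ ψ.order) :
    n ≤ (φ - ψ).order := by
  rw [sub_eq_add_neg]
  exact le_order_add_of_le h₁ (by rwa [order_neg])

/-- `ord φ + ord ψ ≤ ord (φ·ψ)` with natural-number lower bounds. [folklore] -/
theorem le_order_mul_of_le {φ ψ : PowerSeries k} {a b : ℕ} (h₁ : (a : ℕ∞) ≤ φ.order)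
    (h₂ : (b : ℕ∞) ≤ ψ.order) : ((a + b : ℕ) : ℕ∞) ≤ (φ * ψ).order := by
  rw [Nat.cast_add]
  exact (add_le_add h₁ h₂).trans (le_order_mul φ ψ)

/-- The derivative lowers the order by at most one: `n ≤ ord g ⟹ n − 1 ≤ ord g'`. [folklore] -/
theorem le_order_derivative {g : PowerSeries k} {n : ℕ} (h : (n : ℕ∞) ≤ g.order) :
    ((n - 1 : ℕ) : ℕ∞) ≤ (d⁄dX k g).order := by
  refine nat_le_order _ _ fun i hi => ?_
  rw [coeff_derivative, coeff_of_lt_order (i + 1) (lt_of_lt_of_le (by exact_mod_cast (by omega)) h),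
    zero_mul]

/-! ## (a) The invariant derivation in characteristic `2`: `f'' = 0`, `u' = 0 ⟺ u ∈ k⟦t²⟧ ⟹ D∘D = 0` -/

section CharTwo

variable [CharP k 2]

/-- In characteristic `2` every power series has vanishing second derivative:
`(tⁿ)'' = n(n−1)tⁿ⁻²` and `n(n−1)` is even. [folklore] -/
theorem derivative_derivative_eq_zero (f : PowerSeries k) : d⁄dX k (d⁄dX k f) = 0 := by
  ext n
  simp only [coeff_derivative, map_zero]
  have h2 : ((n + 1) * (n + 1 + 1) : ℕ) = ((0 : ℕ) : k) := by
    rw [Nat.cast_zero, CharP.cast_eq_zero_iff k 2]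
    exact even_iff_two_dvd.mp (Nat.even_mul_succ_self (n + 1))
  push_cast at h2 ⊢
  linear_combination (coeff (n + 1 + 1) f) * h2

/-- `f + f = 0` for power series over a ring of characteristic `2`. [folklore] -/
theorem add_self_eq_zero (f : PowerSeries k) : f + f = 0 := by
  ext n
  simp only [map_add, map_zero, CharTwo.add_self_eq_zero]

/-- `-f = f` for power series over a ring of characteristic `2`. [folklore] -/
theorem neg_eq_self (f : PowerSeries k) : -f = f := by
  ext n
  simp only [map_neg, CharTwo.neg_eq]

/-- In characteristic `2`, `u' = 0` iff every odd-degree coefficient of `u` vanishes, i.e. `u ∈ k⟦t²⟧`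
(item (a) of stub S2: `F₂(t̄,0) ∈ 𝔽₄⟦t̄²⟧`). [folklore] -/
theorem derivative_eq_zero_iff_forall_odd (u : PowerSeries k) :
    d⁄dX k u = 0 ↔ ∀ n, Odd n → coeff n u = 0 := by
  constructor
  · intro h n hn
    obtain ⟨j, rfl⟩ := hn
    have := PowerSeries.ext_iff.mp h (2 * j)
    rw [coeff_derivative, map_zero] at this
    have hodd : ((2 * j : ℕ) : k) + 1 = 1 := by
      rw [(CharP.cast_eq_zero_iff k 2 (2 * j)).mpr (dvd_mul_right 2 j), zero_add]
    rwa [hodd, mul_one] at this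
  · intro h
    ext n
    rw [coeff_derivative, map_zero]
    rcases Nat.even_or_odd (n + 1) with hn | hn
    · have : ((n : k) + 1) = 0 := by exact_mod_cast (CharP.cast_eq_zero_iff k 2 (n + 1)).mpr hn.two_dvd
      rw [this, mul_zero]
    · rw [h _ hn, zero_mul]

/-- `u' = 0 ⟹ D∘D = 0` for `D f := u·f'`: indeed `D (D f) = u u' f' + u² f'' = 0` in characteristic `2`
(item (a) of stub S2; the Hasse-invariant input `u ∈ k⟦t²⟧` is `derivative_eq_zero_iff_forall_odd`). [folklore] -/
theorem mul_derivative_mul_derivative_eq_zero {u : PowerSeries k} (hu : d⁄dX k u = 0) (f : PowerSeries k) :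
    u * d⁄dX k (u * d⁄dX k f) = 0 := by
  rw [Derivation.leibniz, hu, derivative_derivative_eq_zero, smul_zero, smul_zero, add_zero, mul_zero]

omit [CharP k 2] in
/-- Converse of `mul_derivative_mul_derivative_eq_zero` over a domain: if `u ≠ 0` and `D∘D = 0` (tested on `f = X`
alone) then `u' = 0`. [folklore] -/
theorem derivative_eq_zero_of_DD_X [NoZeroDivisors k] {u : PowerSeries k} (hu : u ≠ 0)
    (h : u * d⁄dX k (u * d⁄dX k X) = 0) : d⁄dX k u = 0 := by
  rw [derivative_X, mul_one] at h
  rcases mul_eq_zero.mp h with h | h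
  · exact absurd h hu
  · exact h

/-! ## (b) `D log` squares to itself under `D`: `Z·S = D Z`, `u' = 0` ⟹ `D S = S²` -/

/-- **(b) of stub S2.** Over a domain of characteristic `2`: if `u' = 0` (so `D∘D = 0` for `D = u·d/dt`),
`Z ≠ 0` and `S` is the `D`-logarithmic derivative of `Z` in the sense `Z·S = u·Z'`, then `u·S' = S²`
(`D S = S²`).  Proof: differentiate `Z S = u Z'`: `Z' S + Z S' = u' Z' + u Z'' = 0`; multiply by `u`:
`Z S·S + Z·(u S') = 0`, cancel `Z`. [folklore] -/
theorem mul_derivative_eq_sq_of_logDeriv [NoZeroDivisors k] {u Z S : PowerSeries k} (hu : d⁄dX k u = 0)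
    (hZ : Z ≠ 0) (hS : Z * S = u * d⁄dX k Z) : u * d⁄dX k S = S ^ 2 := by
  have h1 : d⁄dX k (Z * S) = d⁄dX k (u * d⁄dX k Z) := by rw [hS]
  rw [Derivation.leibniz, Derivation.leibniz, hu, derivative_derivative_eq_zero, smul_zero, smul_zero,
    add_zero, smul_eq_mul, smul_eq_mul] at h1
  -- `h1 : Z * S' + S * Z' = 0`; multiply by `u` and use `u Z' = Z S`
  have h2 : Z * (u * d⁄dX k S + S ^ 2) = 0 := by
    have := congrArg (fun x => u * x) h1
    simp only [mul_add, mul_zero] at this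
    -- this : u * (Z * S') + u * (S * Z') = 0
    have e : u * (S * d⁄dX k Z) = S * (Z * S) := by rw [hS]; ring
    rw [e] at this
    linear_combination this
  rcases mul_eq_zero.mp h2 with h | h
  · exact absurd h hZ
  · -- `u S' + S² = 0 ⟹ u S' = -S² = S²`
    rw [← neg_eq_self (S ^ 2)]
    exact eq_neg_of_add_eq_zero_left h

omit [CharP k 2] in
/-- `D log` of a product: `Z S = u Z'` and `Z₁ S₁ = u Z₁'` give `(Z Z₁)(S + S₁) = u (Z Z₁)'`
(no characteristic hypothesis). [folklore] -/
theorem logDeriv_mul {u Z S Z₁ S₁ : PowerSeries k} (hS : Z * S = u * d⁄dX k Z)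
    (hS₁ : Z₁ * S₁ = u * d⁄dX k Z₁) : (Z * Z₁) * (S + S₁) = u * d⁄dX k (Z * Z₁) := by
  rw [Derivation.leibniz, smul_eq_mul, smul_eq_mul]
  linear_combination Z₁ * hS + Z * hS₁

end CharTwo

/-! ## Invariance: `u·φ' = u∘φ` (`[h]^*ω = ω`) makes `D` commute with `f ↦ f∘φ` -/

/-- If the substitution `φ` (`φ(0) = 0`) preserves the invariant differential `dt/u`, i.e. `u·φ' = u∘φ`, then
`D (f∘φ) = (D f)∘φ` for `D = u·d/dt` (chain rule).  In the line: `φ = [h_m]`, an automorphism of the formal group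
with `h_m ≡ 1 (mod 2)`. [folklore] -/
theorem mul_derivative_subst_of_invariant {u φ : PowerSeries k} (hφ : constantCoeff φ = 0)
    (hinv : u * d⁄dX k φ = u.subst φ) (f : PowerSeries k) :
    u * d⁄dX k (f.subst φ) = (u * d⁄dX k f).subst φ := by
  have hs : HasSubst φ := HasSubst.of_constantCoeff_zero' hφ
  rw [derivative_subst (A := k) hs, subst_mul hs, ← hinv]
  ring

/-- Transport of the `D log` relation along an invariant substitution: `Z S = u Z'` ⟹ `(Z∘φ)(S∘φ) = u (Z∘φ)'`.
[folklore] -/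
theorem logDeriv_subst {u φ Z S : PowerSeries k} (hφ : constantCoeff φ = 0)
    (hinv : u * d⁄dX k φ = u.subst φ) (hS : Z * S = u * d⁄dX k Z) :
    Z.subst φ * S.subst φ = u * d⁄dX k (Z.subst φ) := by
  have hs : HasSubst φ := HasSubst.of_constantCoeff_zero' hφ
  rw [mul_derivative_subst_of_invariant hφ hinv, ← hS, subst_mul hs]

/-- **The level step of the line.** `Z⁺ := Z·(Z∘φ)` (one more orbit factor) has `D log Z⁺ = S + S∘φ`:
`Z S = u Z'`, `u φ' = u∘φ` ⟹ `Z⁺ · (S + S∘φ) = u · (Z⁺)'`.  This is `S_{m+1} = S_m + S_m∘[h_m]` of stub S2 (d).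
[folklore] -/
theorem logDeriv_levelStep {u φ Z S : PowerSeries k} (hφ : constantCoeff φ = 0)
    (hinv : u * d⁄dX k φ = u.subst φ) (hS : Z * S = u * d⁄dX k Z) :
    (Z * Z.subst φ) * (S + S.subst φ) = u * d⁄dX k (Z * Z.subst φ) :=
  logDeriv_mul hS (logDeriv_subst hφ hinv hS)


/-! ## (d) Second-order Taylor expansion along `X ↦ X + δ`, with the sharp order bound -/

/-- `X + δ` may be substituted when `δ(0) = 0`. [folklore] -/
theorem hasSubst_X_add {δ : PowerSeries k} (hδ : constantCoeff δ = 0) : HasSubst (X + δ) :=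
  HasSubst.of_constantCoeff_zero' (by simp [hδ])

/-- `m ≤ ord (X^m)` over any commutative ring (no nontriviality needed). [folklore] -/
theorem le_order_X_pow (m : ℕ) : (m : ℕ∞) ≤ ((X : PowerSeries k) ^ m).order :=
  nat_le_order _ _ fun i hi => by simp [coeff_X_pow, Nat.ne_of_lt hi]

/-- A lower bound on the order of every term bounds the order of a finite sum. [folklore] -/
theorem le_order_sum {ι : Type*} (s : Finset ι) (F : ι → PowerSeries k) {n : ℕ∞}
    (h : ∀ d ∈ s, n ≤ (F d).order) : n ≤ (∑ d ∈ s, F d).order :=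
  Finset.sum_induction F (fun x => n ≤ x.order) (fun _ _ ha hb => le_order_add_of_le ha hb)
    (by simp) h

/-- **Binomial remainder bound (no binomial sums).** If `1 ≤ N ≤ ord δ` then for every `m`,
`m + 2N − 1 ≤ ord ((X+δ)^{m+1} − X^{m+1} − (m+1)·X^m·δ)`.  Induction on `m` through the identity
`B_{m+2} = (X+δ)·B_{m+1} + (m+1)·X^m·δ²`. [folklore] -/
theorem le_order_binomialRemainder {δ : PowerSeries k} {N : ℕ} (hN : 1 ≤ N) (hδ : (N : ℕ∞) ≤ δ.order)
    (m : ℕ) : ((m + 2 * N - 1 : ℕ) : ℕ∞) ≤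
      ((X + δ) ^ (m + 1) - X ^ (m + 1) - ((m + 1 : ℕ) : PowerSeries k) * X ^ m * δ).order := by
  induction m with
  | zero =>
    have : (X + δ) ^ (0 + 1) - X ^ (0 + 1) - ((0 + 1 : ℕ) : PowerSeries k) * X ^ 0 * δ = 0 := by
      push_cast; ring
    rw [this, order_zero]; exact le_top
  | succ m ih =>
    have key : (X + δ) ^ (m + 1 + 1) - X ^ (m + 1 + 1) - ((m + 1 + 1 : ℕ) : PowerSeries k) * X ^ (m + 1) * δ
        = (X + δ) * ((X + δ) ^ (m + 1) - X ^ (m + 1) - ((m + 1 : ℕ) : PowerSeries k) * X ^ m * δ)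
          + ((m + 1 : ℕ) : PowerSeries k) * X ^ m * (δ * δ) := by
      push_cast; ring
    rw [key, show m + 1 + 2 * N - 1 = m + 2 * N by omega]
    have h1 : ((1 : ℕ) : ℕ∞) ≤ (X + δ).order :=
      le_order_add_of_le (by simpa using le_order_X_pow (k := k) 1)
        (le_trans (by exact_mod_cast hN) hδ)
    refine le_order_add_of_le ?_ ?_
    · have := le_order_mul_of_le h1 ih
      rwa [show 1 + (m + 2 * N - 1) = m + 2 * N by omega] at this
    · have hc : ((0 : ℕ) : ℕ∞) ≤ (((m + 1 : ℕ) : PowerSeries k)).order := by simp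
      have := le_order_mul_of_le (le_order_mul_of_le hc (le_order_X_pow (k := k) m))
        (le_order_mul_of_le hδ hδ)
      rwa [show 0 + m + (N + N) = m + 2 * N by omega] at this

/-- The truncation of `f` to degrees `≤ i`, written as `f₀ + Σ_{d<i} f_{d+1} X^{d+1}` (this shape avoids `X^(d-1)`
in the derivative).  Its difference with `f` has order `≥ i + 1`. [folklore] -/
theorem le_order_sub_truncSum (f : PowerSeries k) (i : ℕ) :
    ((i + 1 : ℕ) : ℕ∞) ≤ (f - (C (coeff 0 f) +
      ∑ d ∈ Finset.range i, C (coeff (d + 1) f) * X ^ (d + 1))).order := by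
  refine nat_le_order _ _ fun j hj => ?_
  simp only [map_sub, map_add, map_sum, coeff_C_mul, coeff_X_pow, coeff_C, mul_ite, mul_one, mul_zero]
  rcases j with _ | j
  · simp
  · simp only [Nat.succ_ne_zero, if_false, zero_add, add_left_inj, Finset.sum_ite_eq, Finset.mem_range]
    rw [if_pos (by omega), sub_self]

/-- Exact second-order Taylor formula for the truncated sums: with `B_{d+1} := (X+δ)^{d+1} − X^{d+1} − (d+1)X^dδ`,
`P(X+δ) − P − P'·δ = Σ_{d<i} f_{d+1}·B_{d+1}` for `P = f₀ + Σ_{d<i} f_{d+1} X^{d+1}`. [folklore] -/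
theorem truncSum_taylor (f δ : PowerSeries k) (hδ : constantCoeff δ = 0) (i : ℕ) :
    (C (coeff 0 f) + ∑ d ∈ Finset.range i, C (coeff (d + 1) f) * X ^ (d + 1)).subst (X + δ)
      - (C (coeff 0 f) + ∑ d ∈ Finset.range i, C (coeff (d + 1) f) * X ^ (d + 1))
      - d⁄dX k (C (coeff 0 f) + ∑ d ∈ Finset.range i, C (coeff (d + 1) f) * X ^ (d + 1)) * δ
    = ∑ d ∈ Finset.range i, C (coeff (d + 1) f) *
        ((X + δ) ^ (d + 1) - X ^ (d + 1) - ((d + 1 : ℕ) : PowerSeries k) * X ^ d * δ) := by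
  have hs : HasSubst (X + δ) := hasSubst_X_add hδ
  have hsub : (C (coeff 0 f) + ∑ d ∈ Finset.range i, C (coeff (d + 1) f) * X ^ (d + 1)).subst (X + δ)
      = C (coeff 0 f) + ∑ d ∈ Finset.range i, C (coeff (d + 1) f) * (X + δ) ^ (d + 1) := by
    rw [← coe_substAlgHom hs]
    simp only [map_add, map_sum, map_mul, map_pow, C_eq_algebraMap, AlgHom.commutes]
    rw [coe_substAlgHom hs, subst_X hs]
  have hder : d⁄dX k (C (coeff 0 f) + ∑ d ∈ Finset.range i, C (coeff (d + 1) f) * X ^ (d + 1))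
      = ∑ d ∈ Finset.range i, C (coeff (d + 1) f) * (((d + 1 : ℕ) : PowerSeries k) * X ^ d) := by
    simp only [map_add, map_sum, derivative_C, zero_add]
    refine Finset.sum_congr rfl fun d _ => ?_
    rw [Derivation.leibniz, derivative_C, smul_zero, add_zero, smul_eq_mul, derivative_pow k, derivative_X,
      mul_one, Nat.add_sub_cancel]
  rw [hsub, hder, Finset.sum_mul]
  simp only [add_sub_add_left_eq_sub, ← Finset.sum_sub_distrib]
  exact Finset.sum_congr rfl fun d _ => by ring

/-- **(d) of stub S2 — second-order Taylor bound.**  For `f, δ ∈ k⟦X⟧` with `1 ≤ N ≤ ord δ` and `v ≤ ord f`: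
`2N + v − 2 ≤ ord (f(X+δ) − f − f'·δ)`.  (The coefficient of `yⁿ` in `f(t ⊕ y)` has `t`-order `≥ ord f − n`;
only `n ≥ 2` survives in the remainder.)  This sharp form — not just `δ² ∣ remainder` — is what the recursion needs:
at level `m = 1` of the calibration class the margin is exactly `2`. [folklore] -/
theorem le_order_taylorRemainder {f δ : PowerSeries k} {N v : ℕ} (hN : 1 ≤ N) (hδ : (N : ℕ∞) ≤ δ.order)
    (hf : (v : ℕ∞) ≤ f.order) :
    ((2 * N + v - 2 : ℕ) : ℕ∞) ≤
      PowerSeries.order ((f.subst (X + δ) : PowerSeries k) - f - d⁄dX k f * δ) := by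
  have hδ0 : constantCoeff δ = 0 := by
    have h0 := coeff_of_lt_order (φ := δ) 0 (lt_of_lt_of_le (by exact_mod_cast hN) hδ)
    rwa [coeff_zero_eq_constantCoeff_apply] at h0
  have hs : HasSubst (X + δ) := hasSubst_X_add hδ0
  have hXδ : constantCoeff (X + δ) = 0 := by simp [hδ0]
  refine nat_le_order _ _ fun i hi => ?_
  -- split `f = P + g`, `P` the truncation to degrees `≤ i`
  set P : PowerSeries k := C (coeff 0 f) + ∑ d ∈ Finset.range i, C (coeff (d + 1) f) * X ^ (d + 1) with hP
  set g : PowerSeries k := f - P with hg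
  have hgord : ((i + 1 : ℕ) : ℕ∞) ≤ g.order := le_order_sub_truncSum f i
  have hsplit : (f.subst (X + δ) : PowerSeries k) - f - d⁄dX k f * δ
      = ((P.subst (X + δ) : PowerSeries k) - P - d⁄dX k P * δ)
        + ((g.subst (X + δ) : PowerSeries k) - g - d⁄dX k g * δ) := by
    have hfPg : f = P + g := by rw [hg]; ring
    conv_lhs => rw [hfPg]
    rw [subst_add hs, map_add]
    ring
  rw [hsplit, map_add]
  -- the `P`-piece: exact Taylor, every term of order `≥ 2N + v - 2`
  have hPpiece : ((2 * N + v - 2 : ℕ) : ℕ∞) ≤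
      PowerSeries.order ((P.subst (X + δ) : PowerSeries k) - P - d⁄dX k P * δ) := by
    rw [hP, truncSum_taylor f δ hδ0 i]
    refine le_order_sum _ _ fun d _ => ?_
    by_cases hd : d + 1 < v
    · rw [coeff_of_lt_order (d + 1) (lt_of_lt_of_le (by exact_mod_cast hd) hf), map_zero, zero_mul,
        order_zero]
      exact le_top
    · have hB := le_order_binomialRemainder (k := k) hN hδ d
      have hc : ((0 : ℕ) : ℕ∞) ≤ (C (coeff (d + 1) f) : PowerSeries k).order := by simp
      refine le_trans ?_ (le_order_mul_of_le hc hB)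
      exact_mod_cast (by omega)
  -- the `g`-piece: every summand has order `> i`
  have h1 : coeff i (g.subst (X + δ)) = 0 :=
    coeff_of_lt_order i (lt_of_lt_of_le (by exact_mod_cast Nat.lt_succ_self i)
      (hgord.trans (le_order_subst_left' hXδ)))
  have h2 : coeff i g = 0 := coeff_of_lt_order i (lt_of_lt_of_le (by exact_mod_cast Nat.lt_succ_self i) hgord)
  have h3 : coeff i (d⁄dX k g * δ) = 0 := by
    refine coeff_of_lt_order i (lt_of_lt_of_le ?_ (le_order_mul_of_le (le_order_derivative hgord) hδ))
    exact_mod_cast (by omega)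
  rw [coeff_of_lt_order i (lt_of_lt_of_le (by exact_mod_cast hi) hPpiece), map_sub, map_sub, h1, h2, h3]
  simp


/-! ## The CLAIM of stub S2: `v(S_m) < 4^{m+1} − 2 ⟹ v(S_{m+1}) = 2·v(S_m) + 4^{m+1}` -/

/-- **Stub S2 `TiltRecursion` — the CLAIM, abstract form.**  Over a domain `k` of characteristic `2`:
let `D = u·d/dt` and `S ∈ k⟦t⟧` with `D S = S²` (item (b)); let `φ = t + u·y + y²·r` be the translation
`t ↦ t ⊕ y` of a one-dimensional formal group with `u = ∂₂F(t,0)` (so `[h_m]t = t ⊕ y_m`, item (c)); if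
`ord S = v`, `ord y = N` and `v + 2 < N`, then `ord (S + S∘φ) = 2v + N`.
Proof: `S + S(t ⊕ y) = (D S)·y + S'·y²r + E = S²·y + (terms of order ≥ 2v + N + 1)` by the Taylor bound (d).
In the line: `S = S_m`, `y = y_m` with `N = 4^{m+1}`, and `S + S∘φ = S_{m+1}` (`logDeriv_levelStep`). [folklore] -/
theorem order_add_subst_eq [NoZeroDivisors k] [CharP k 2] {u S y r φ : PowerSeries k} {v N : ℕ}
    (hDS : u * d⁄dX k S = S ^ 2) (hφ : φ = X + u * y + y ^ 2 * r)
    (hS : S.order = v) (hy : y.order = N) (hvN : v + 2 < N) :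
    PowerSeries.order (S + (S.subst φ : PowerSeries k)) = (2 * v + N : ℕ) := by
  have hN : 1 ≤ N := by omega
  have h0 : ((0 : ℕ) : ℕ∞) ≤ u.order := by simp
  have hr : ((0 : ℕ) : ℕ∞) ≤ r.order := by simp
  have hδ : (N : ℕ∞) ≤ (u * y + y ^ 2 * r).order := by
    refine le_order_add_of_le ?_ ?_
    · simpa using le_order_mul_of_le h0 hy.ge
    · rw [pow_two]
      exact le_trans (by exact_mod_cast (by omega))
        (le_order_mul_of_le (le_order_mul_of_le hy.ge hy.ge) hr)
  have hφ' : φ = X + (u * y + y ^ 2 * r) := by rw [hφ]; ring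
  -- the decomposition `S + S∘φ = S²·y + (S'·y²r + TaylorRemainder)`
  have hE : S + (S.subst φ : PowerSeries k) = S ^ 2 * y + (d⁄dX k S * (y ^ 2 * r) +
      ((S.subst (X + (u * y + y ^ 2 * r)) : PowerSeries k) - S - d⁄dX k S * (u * y + y ^ 2 * r))) := by
    rw [hφ']
    linear_combination add_self_eq_zero S + y * hDS
  -- orders
  have hmain : PowerSeries.order (S ^ 2 * y) = ((2 * v + N : ℕ) : ℕ∞) := by
    rw [pow_two, order_mul, order_mul, hS, hy]
    push_cast
    ring
  have hrest : ((2 * v + N + 1 : ℕ) : ℕ∞) ≤ PowerSeries.order (d⁄dX k S * (y ^ 2 * r) +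
      ((S.subst (X + (u * y + y ^ 2 * r)) : PowerSeries k) - S - d⁄dX k S * (u * y + y ^ 2 * r))) := by
    refine le_order_add_of_le ?_ ?_
    · rw [pow_two]
      refine le_trans ?_ (le_order_mul_of_le (le_order_derivative hS.ge)
        (le_order_mul_of_le (le_order_mul_of_le hy.ge hy.ge) hr))
      exact_mod_cast (by omega)
    · exact le_trans (by exact_mod_cast (by omega)) (le_order_taylorRemainder (f := S) hN hδ hS.ge)
  rw [hE, order_add_of_order_ne, hmain]
  · exact min_eq_left (le_trans (by exact_mod_cast (by omega)) hrest)
  · rw [hmain]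
    intro h
    have := h.symm ▸ hrest
    exact absurd this (by exact_mod_cast (by omega))

/-- **Stub S2, assembled at one level.**  Data of a level: `Z ≠ 0` with `Z·S = D Z` (`S = D log Z`), `u' = 0`
(supersingularity, item (a)), a translation `φ = t + u y + y² r` preserving `dt/u`; the next level is
`Z⁺ = Z·(Z∘φ)`, `S⁺ = S + S∘φ` (`logDeriv_levelStep`).  Then `ord S = v`, `ord y = N`, `v + 2 < N` ⟹
`ord S⁺ = 2v + N`. [folklore] -/
theorem tiltRecursion_step [NoZeroDivisors k] [CharP k 2] {u Z S y r φ : PowerSeries k} {v N : ℕ}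
    (hu : d⁄dX k u = 0) (hZ : Z ≠ 0) (hZS : Z * S = u * d⁄dX k Z) (hφ : φ = X + u * y + y ^ 2 * r)
    (hS : S.order = v) (hy : y.order = N) (hvN : v + 2 < N) :
    PowerSeries.order (S + (S.subst φ : PowerSeries k)) = (2 * v + N : ℕ) :=
  order_add_subst_eq (mul_derivative_eq_sq_of_logDeriv hu hZ hZS) hφ hS hy hvN

end Summit.BirchSwinnertonDyer.BirchSwinnertonDyer.Theorems.SignedMuAtTwo.Tilt

end
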